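import Summits.BirchSwinnertonDyer.Rank1Residual.X11a.VisibilityRecordsNoRam
import Summits.BirchSwinnertonDyer.Rank1Residual.X11a.VisibilityRecords8
import Summits.BirchSwinnertonDyer.Rank1Residual.X11a.VisibilityRecords9
import Summits.BirchSwinnertonDyer.Rank1Residual.X11a.VisibilityRecords15
import Summits.BirchSwinnertonDyer.Rank1Residual.X11a.VisibilityRecords16
import Summits.BirchSwinnertonDyer.Rank1Residual.X11b.MultiplicativeSurjectivity
import Summits.BirchSwinnertonDyer.Rank1Residual.X11b.CertificateCheckBridge
import Literature.NumberTheory.EllipticCurves.OrdinaryPrimesProofs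
import Literature.NumberTheory.EllipticCurves.LFunctionPrimeCoeff
import Literature.NumberTheory.DiophantineGeometry.LocalReduction
import HarnessLib

/-!
# Class X11a — per-pair VISIBILITY records with the CLASS ATOMS in the kernel, file 7
# (cell `bsd-print-x11a`, seat p4)

HONEST FRAMING (cells `b2b-bsdres` / `bsd-print-x11a`, verbatim): the goal is to DELETE the
COMBINATION-SHAPED residual classes of the Birch–Swinnerton-Dyer formula for ALL analytic-rank
`≤ 1` elliptic curves over `ℚ` — "full BSD formula for every rank `≤ 1` curve in class `C`"
assembled STRICTLY from published theorems — so that the rank-`≤ 1` remainder becomes exactly the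
CONSTRUCTION-SHAPED classes, which are TYPED (missing-input `Prop`s), NOT attempted. This is not
"finishing BSD". PER PAIR: theorems only, no definition, no named fact; nothing is booked by this
file and no class label changes (referee / planner).

## What

For every record `bsdp<p>_v<label>` of `X11a/VisibilityRecords1…32.lean` (94 rank-`0` X11-type
pairs of the x11a gen-9 census) this file discharges the displayed class binder `hX : ClassX11a W p`
IN THE KERNEL up to the analytic rank: `classX11a_c<label> : W = ⟨…⟩ → W.analyticRank = 0 →
ClassX11a W p` — `p ∥ N` from the integral model (`p ∣ Δ`, `p ∤ c₄`; Silverman VII.5.1 (b)),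
`E[p]` irreducible by a Frobenius witness (a good prime `ℓ` with `X² − a_ℓ X + ℓ` irreducible mod
`p`, `a_ℓ` from the kernel point count `countPoints`; Mazur 1978 Prop. 6.3 (1), tree
`hasIrreducibleModPGaloisRep_of_intModel_of_noroot`), and NO (ram) prime by `not_ram_of_intModel`
(`X11a/VisibilityRecordsNoRam.lean`: every prime of `Δ` is `p`, additive, or multiplicative with `p ∣ ord_ℓ Δ`) — and restates the
record as `bsdp<p>_a<label>` with `hr : W.analyticRank = 0` in place of `hX`, the image bit
`ρ̄_{E,p}` onto in the kernel wherever `E` is très ramifié at `p` (x11c's `ClassX11a.surj_of_not_dvd`).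
Displayed binders LEFT per record: `hr` (`r_an = 0`, Cremona `allbsd`), `hq`/`hv` (`#Ш_an = p²`),
`θ`/`hθ` (the `p`-congruence, Sturm two-engine, x11a g9), `hrank` (`rank F(ℚ) = 2`, Cremona),
and `hsurj` only at the peu ramifié rows.

References: [SilvermanAEC2009] VII.5.1; [Mazur1978] Prop. 6.3; [SerreInventiones1972] §2.4 Prop. 15;
[Wuthrich2014] Prop. 21; [CremonaMazur2000] §3; [Miller2011LMS] Def. 1.1; [Cremona2006];
`X11a/VisibilityRecords1.lean` (template); HOME `run/shared/lean/pub/bsd-print-x11a/P4-RECORDS-TABLE.md`.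
-/

set_option autoImplicit false

noncomputable section

open scoped Classical

open WeierstrassCurve Literature.NumberTheory.EllipticCurves
  Literature.NumberTheory.EllipticCurves.Rank1Residual
  Literature.NumberTheory.EllipticCurves.Rank1Residual.Typed
  Literature.NumberTheory.EllipticCurves.Rank1Residual.X11RankOneCertificates
  Literature.NumberTheory.EllipticCurves.Wuthrich2014
  NumberField IsDedekindDomain Rat.HeightOneSpectrum
  Summit.BirchSwinnertonDyer.BirchSwinnertonDyer.Rank1Residual.IntModel

namespace Summit.BirchSwinnertonDyer.Rank1Residual.X11a.VisibilityRecords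

/-! ### `261360ge1 @ 5` -/

/-- **`261360ge1 = [0, 0, 0, -395307, -100012671]` lies in class X11a at `5`, in the KERNEL up to `r_an = 0`**: `5 ∥ N`
(`5 ∣ Δ = ±2⁴·3¹¹·5·11¹⁰`, `5 ∤ c₄`: multiplicative, Silverman VII.5.1 (b)); `E[5]` irreducible by the
Frobenius witness `ℓ = 23` (`#Ẽ(𝔽_23) = 24`, `a_23 = 0`, `X² − a_23X + 23` has no root mod `5`;
Mazur 1978 Prop. 6.3 (1)); no (ram) prime (`2` additive; `3` additive; `5 = p`; `11` additive). Displayed: `hr` (`r_an = 0`, Cremona).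
[cite: SilvermanAEC2009, VII.5 Prop. 5.1] [cite: Mazur1978, §6 Prop. 6.3 (1) (p. 153)] [cite: Cremona2006, Table 1 (Cremona label 261360ge1)] -/
theorem classX11a_c261360ge1 (W : WeierstrassCurve ℚ) [W.IsElliptic] [W.IsGloballyMinimal] [Fact (Nat.Prime 5)]
    (hWeq : W = ⟨0, 0, 0, -395307, -100012671⟩) (hr : W.analyticRank = 0) : ClassX11a W 5 := by
  haveI : Fact (Nat.Prime 2) := ⟨Nat.prime_two⟩
  haveI : Fact (Nat.Prime 3) := ⟨Nat.prime_three⟩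
  haveI : Fact (Nat.Prime 11) := ⟨by norm_num⟩
  haveI : Fact (Nat.Prime 23) := ⟨by norm_num⟩
  have hI : integralModelInt W = ⟨0, 0, 0, -395307, -100012671⟩ := by
    subst hWeq; exact integralModelInt_eq_of_map_eq _ (map_mk_int 0 0 0 (-395307) (-100012671))
  have hmult : Mult W 5 :=
    hasMultiplicativeReductionAtPrime_of_intModel hI 5 (by decide +kernel) (by decide +kernel)
  have hirr : Irr W 5 := by
    have hc : Nat.card (((⟨0, 0, 0, -395307, -100012671⟩ : WeierstrassCurve ℤ).map
        (Int.castRingHom (ZMod 23))).toAffine.Point) = 24 := by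
      have h := X11b.natCard_point_eq_countPoints 0 0 0 (-395307) (-100012671) 23 (by norm_num)
        (by decide +kernel)
      have h' : countPoints [0, 0, 0, -395307, -100012671] 23 = 24 := by decide +kernel
      exact_mod_cast h.trans h'
    exact hasIrreducibleModPGaloisRep_of_intModel_of_noroot (hp := ⟨by norm_num⟩) (hℓ := ⟨by norm_num⟩)
      hI 5 23 (by norm_num) (by decide +kernel) hc (by decide)
  have hnram : ¬ Ram W 5 := not_ram_of_intModel hI 5 [2, 3, 5, 11] [4, 11, 1, 10]
    (by intro q hq; simp only [List.mem_cons, List.mem_nil_iff, or_false] at hq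
        rcases hq with rfl | rfl | rfl | rfl <;> norm_num) (by decide +kernel)
    (by intro ℓ hℓ; simp only [List.mem_cons, List.mem_nil_iff, or_false] at hℓ
        rcases hℓ with rfl | rfl | rfl | rfl
        · exact Or.inr (Or.inl (by decide +kernel))
        · exact Or.inr (Or.inl (by decide +kernel))
        · exact Or.inl rfl
        · exact Or.inr (Or.inl (by decide +kernel)))
  exact ⟨hr, by decide, hmult, hirr, hnram⟩

/-- **`261360ge1 @ 5`: `BSD(E,5)` with the class atoms in the kernel** — `bsdp5_v261360ge1`
(`X11a/VisibilityRecords15.lean`) with `hX` supplied by `classX11a_c261360ge1`; image bit in the kernel (très ramifié, `ClassX11a.surj_of_not_dvd`). Displayed binders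
left: `hr` (`r_an = 0`), `hq`/`hv` (`#Ш_an = 25`), `θ`/`hθ` (the `5`-congruence), `hrank` (`rank F(ℚ) = 2`).
PER PAIR; nothing booked. [cite: Wuthrich2014, Prop. 21 (p. 400)] [cite: CremonaMazur2000, §3 and Table 1]
[cite: Cremona2006, Table 1 (Cremona label 261360ge1)] -/
theorem bsdp5_a261360ge1 (hCT : exists_casselsTate_pairing (K := ℚ)) (hW : sha_dvd_analyticSha)
    (hGZK : rank_eq_analyticRank_of_analyticRank_le_one) (hmod : hasEntireLFunction_rat)
    (W : WeierstrassCurve ℚ) [W.IsElliptic] [W.IsGloballyMinimal] [Fact (Nat.Prime 5)]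
    (hWeq : W = ⟨0, 0, 0, -395307, -100012671⟩) (hr : W.analyticRank = 0)
    {q : ℚ} (hq : shaAn W = (q : ℂ)) (hv : padicValRat 5 q ≤ 2)
    (W' : WeierstrassCurve ℚ) (hW' : W' = ⟨0, 0, 0, -49467, 4236474⟩) [W'.IsElliptic]
    (θ : geomTorsion W' ((5 : ℕ) : ℤ) ≃+ geomTorsion W ((5 : ℕ) : ℤ))
    (hθ : ∀ (σ : Field.absoluteGaloisGroup ℚ) (P : geomTorsion W' ((5 : ℕ) : ℤ)),
      θ (σ • P) = σ • θ P)
    (hrank : 2 ≤ W'.mordellWeilRank) : BSDp W 5 := by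
  have hX : ClassX11a W 5 := classX11a_c261360ge1 W hWeq hr
  have hsurj : Surj W 5 := ClassX11a.surj_of_not_dvd W 5 hX (by
    rw [minimalDiscriminantInt_eq (integralModelInt_eq_of_map_eq (W := W) _ (by rw [hWeq]; exact map_mk_int 0 0 0 (-395307) (-100012671))),
      padicValInt_eq_of_dvd_of_not_dvd 5 (e := 1) (by decide +kernel) (by decide +kernel)]
    decide)
  exact bsdp5_v261360ge1 hCT hW hGZK hmod W hWeq hX hsurj hq hv W' hW' θ hθ hrank

/-! ### `283220bp1 @ 5` -/

/-- **`283220bp1 = [0, -1, 0, 299557074, -10988300880199]` lies in class X11a at `5`, in the KERNEL up to `r_an = 0`**: `5 ∥ N`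
(`5 ∣ Δ = ±2⁴·5¹²·7¹¹·17⁸`, `5 ∤ c₄`: multiplicative, Silverman VII.5.1 (b)); `E[5]` irreducible by the
Frobenius witness `ℓ = 3` (`#Ẽ(𝔽_3) = 2`, `a_3 = 2`, `X² − a_3X + 3` has no root mod `5`;
Mazur 1978 Prop. 6.3 (1)); no (ram) prime (`2` additive; `5 = p`; `7` additive; `17` additive). Displayed: `hr` (`r_an = 0`, Cremona).
[cite: SilvermanAEC2009, VII.5 Prop. 5.1] [cite: Mazur1978, §6 Prop. 6.3 (1) (p. 153)] [cite: Cremona2006, Table 1 (Cremona label 283220bp1)] -/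
theorem classX11a_c283220bp1 (W : WeierstrassCurve ℚ) [W.IsElliptic] [W.IsGloballyMinimal] [Fact (Nat.Prime 5)]
    (hWeq : W = ⟨0, -1, 0, 299557074, -10988300880199⟩) (hr : W.analyticRank = 0) : ClassX11a W 5 := by
  haveI : Fact (Nat.Prime 2) := ⟨Nat.prime_two⟩
  haveI : Fact (Nat.Prime 3) := ⟨Nat.prime_three⟩
  haveI : Fact (Nat.Prime 7) := ⟨by norm_num⟩
  haveI : Fact (Nat.Prime 17) := ⟨by norm_num⟩
  have hI : integralModelInt W = ⟨0, -1, 0, 299557074, -10988300880199⟩ := by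
    subst hWeq; exact integralModelInt_eq_of_map_eq _ (map_mk_int 0 (-1) 0 299557074 (-10988300880199))
  have hmult : Mult W 5 :=
    hasMultiplicativeReductionAtPrime_of_intModel hI 5 (by decide +kernel) (by decide +kernel)
  have hirr : Irr W 5 := by
    have hc : Nat.card (((⟨0, -1, 0, 299557074, -10988300880199⟩ : WeierstrassCurve ℤ).map
        (Int.castRingHom (ZMod 3))).toAffine.Point) = 2 := by
      have h := X11b.natCard_point_eq_countPoints 0 (-1) 0 299557074 (-10988300880199) 3 (by norm_num)
        (by decide +kernel)
      have h' : countPoints [0, -1, 0, 299557074, -10988300880199] 3 = 2 := by decide +kernel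
      exact_mod_cast h.trans h'
    exact hasIrreducibleModPGaloisRep_of_intModel_of_noroot (hp := ⟨by norm_num⟩) (hℓ := ⟨by norm_num⟩)
      hI 5 3 (by norm_num) (by decide +kernel) hc (by decide)
  have hnram : ¬ Ram W 5 := not_ram_of_intModel hI 5 [2, 5, 7, 17] [4, 12, 11, 8]
    (by intro q hq; simp only [List.mem_cons, List.mem_nil_iff, or_false] at hq
        rcases hq with rfl | rfl | rfl | rfl <;> norm_num) (by decide +kernel)
    (by intro ℓ hℓ; simp only [List.mem_cons, List.mem_nil_iff, or_false] at hℓ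
        rcases hℓ with rfl | rfl | rfl | rfl
        · exact Or.inr (Or.inl (by decide +kernel))
        · exact Or.inl rfl
        · exact Or.inr (Or.inl (by decide +kernel))
        · exact Or.inr (Or.inl (by decide +kernel)))
  exact ⟨hr, by decide, hmult, hirr, hnram⟩

/-- **`283220bp1 @ 5`: `BSD(E,5)` with the class atoms in the kernel** — `bsdp5_v283220bp1`
(`X11a/VisibilityRecords8.lean`) with `hX` supplied by `classX11a_c283220bp1`; image bit in the kernel (très ramifié, `ClassX11a.surj_of_not_dvd`). Displayed binders
left: `hr` (`r_an = 0`), `hq`/`hv` (`#Ш_an = 25`), `θ`/`hθ` (the `5`-congruence), `hrank` (`rank F(ℚ) = 2`).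
PER PAIR; nothing booked. [cite: Wuthrich2014, Prop. 21 (p. 400)] [cite: CremonaMazur2000, §3 and Table 1]
[cite: Cremona2006, Table 1 (Cremona label 283220bp1)] -/
theorem bsdp5_a283220bp1 (hCT : exists_casselsTate_pairing (K := ℚ)) (hW : sha_dvd_analyticSha)
    (hGZK : rank_eq_analyticRank_of_analyticRank_le_one) (hmod : hasEntireLFunction_rat)
    (W : WeierstrassCurve ℚ) [W.IsElliptic] [W.IsGloballyMinimal] [Fact (Nat.Prime 5)]
    (hWeq : W = ⟨0, -1, 0, 299557074, -10988300880199⟩) (hr : W.analyticRank = 0)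
    {q : ℚ} (hq : shaAn W = (q : ℂ)) (hv : padicValRat 5 q ≤ 2)
    (W' : WeierstrassCurve ℚ) (hW' : W' = ⟨0, -1, 0, -2567861, 1583906801⟩) [W'.IsElliptic]
    (θ : geomTorsion W' ((5 : ℕ) : ℤ) ≃+ geomTorsion W ((5 : ℕ) : ℤ))
    (hθ : ∀ (σ : Field.absoluteGaloisGroup ℚ) (P : geomTorsion W' ((5 : ℕ) : ℤ)),
      θ (σ • P) = σ • θ P)
    (hrank : 2 ≤ W'.mordellWeilRank) : BSDp W 5 := by
  have hX : ClassX11a W 5 := classX11a_c283220bp1 W hWeq hr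
  have hsurj : Surj W 5 := ClassX11a.surj_of_not_dvd W 5 hX (by
    rw [minimalDiscriminantInt_eq (integralModelInt_eq_of_map_eq (W := W) _ (by rw [hWeq]; exact map_mk_int 0 (-1) 0 299557074 (-10988300880199))),
      padicValInt_eq_of_dvd_of_not_dvd 5 (e := 12) (by decide +kernel) (by decide +kernel)]
    decide)
  exact bsdp5_v283220bp1 hCT hW hGZK hmod W hWeq hX hsurj hq hv W' hW' θ hθ hrank

/-! ### `283220bp2 @ 5` -/

/-- **`283220bp2 = [0, -1, 0, -2709655426, 305187850967301]` lies in class X11a at `5`, in the KERNEL up to `r_an = 0`**: `5 ∥ N`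
(`5 ∣ Δ = ±2⁴·5⁴·7²¹·17⁸`, `5 ∤ c₄`: multiplicative, Silverman VII.5.1 (b)); `E[5]` irreducible by the
Frobenius witness `ℓ = 3` (`#Ẽ(𝔽_3) = 2`, `a_3 = 2`, `X² − a_3X + 3` has no root mod `5`;
Mazur 1978 Prop. 6.3 (1)); no (ram) prime (`2` additive; `5 = p`; `7` additive; `17` additive). Displayed: `hr` (`r_an = 0`, Cremona).
[cite: SilvermanAEC2009, VII.5 Prop. 5.1] [cite: Mazur1978, §6 Prop. 6.3 (1) (p. 153)] [cite: Cremona2006, Table 1 (Cremona label 283220bp2)] -/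
theorem classX11a_c283220bp2 (W : WeierstrassCurve ℚ) [W.IsElliptic] [W.IsGloballyMinimal] [Fact (Nat.Prime 5)]
    (hWeq : W = ⟨0, -1, 0, -2709655426, 305187850967301⟩) (hr : W.analyticRank = 0) : ClassX11a W 5 := by
  haveI : Fact (Nat.Prime 2) := ⟨Nat.prime_two⟩
  haveI : Fact (Nat.Prime 3) := ⟨Nat.prime_three⟩
  haveI : Fact (Nat.Prime 7) := ⟨by norm_num⟩
  haveI : Fact (Nat.Prime 17) := ⟨by norm_num⟩
  have hI : integralModelInt W = ⟨0, -1, 0, -2709655426, 305187850967301⟩ := by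
    subst hWeq; exact integralModelInt_eq_of_map_eq _ (map_mk_int 0 (-1) 0 (-2709655426) 305187850967301)
  have hmult : Mult W 5 :=
    hasMultiplicativeReductionAtPrime_of_intModel hI 5 (by decide +kernel) (by decide +kernel)
  have hirr : Irr W 5 := by
    have hc : Nat.card (((⟨0, -1, 0, -2709655426, 305187850967301⟩ : WeierstrassCurve ℤ).map
        (Int.castRingHom (ZMod 3))).toAffine.Point) = 2 := by
      have h := X11b.natCard_point_eq_countPoints 0 (-1) 0 (-2709655426) 305187850967301 3 (by norm_num)
        (by decide +kernel)
      have h' : countPoints [0, -1, 0, -2709655426, 305187850967301] 3 = 2 := by decide +kernel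
      exact_mod_cast h.trans h'
    exact hasIrreducibleModPGaloisRep_of_intModel_of_noroot (hp := ⟨by norm_num⟩) (hℓ := ⟨by norm_num⟩)
      hI 5 3 (by norm_num) (by decide +kernel) hc (by decide)
  have hnram : ¬ Ram W 5 := not_ram_of_intModel hI 5 [2, 5, 7, 17] [4, 4, 21, 8]
    (by intro q hq; simp only [List.mem_cons, List.mem_nil_iff, or_false] at hq
        rcases hq with rfl | rfl | rfl | rfl <;> norm_num) (by decide +kernel)
    (by intro ℓ hℓ; simp only [List.mem_cons, List.mem_nil_iff, or_false] at hℓ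
        rcases hℓ with rfl | rfl | rfl | rfl
        · exact Or.inr (Or.inl (by decide +kernel))
        · exact Or.inl rfl
        · exact Or.inr (Or.inl (by decide +kernel))
        · exact Or.inr (Or.inl (by decide +kernel)))
  exact ⟨hr, by decide, hmult, hirr, hnram⟩

/-- **`283220bp2 @ 5`: `BSD(E,5)` with the class atoms in the kernel** — `bsdp5_v283220bp2`
(`X11a/VisibilityRecords8.lean`) with `hX` supplied by `classX11a_c283220bp2`; image bit in the kernel (très ramifié, `ClassX11a.surj_of_not_dvd`). Displayed binders
left: `hr` (`r_an = 0`), `hq`/`hv` (`#Ш_an = 25`), `θ`/`hθ` (the `5`-congruence), `hrank` (`rank F(ℚ) = 2`).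
PER PAIR; nothing booked. [cite: Wuthrich2014, Prop. 21 (p. 400)] [cite: CremonaMazur2000, §3 and Table 1]
[cite: Cremona2006, Table 1 (Cremona label 283220bp2)] -/
theorem bsdp5_a283220bp2 (hCT : exists_casselsTate_pairing (K := ℚ)) (hW : sha_dvd_analyticSha)
    (hGZK : rank_eq_analyticRank_of_analyticRank_le_one) (hmod : hasEntireLFunction_rat)
    (W : WeierstrassCurve ℚ) [W.IsElliptic] [W.IsGloballyMinimal] [Fact (Nat.Prime 5)]
    (hWeq : W = ⟨0, -1, 0, -2709655426, 305187850967301⟩) (hr : W.analyticRank = 0)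
    {q : ℚ} (hq : shaAn W = (q : ℂ)) (hv : padicValRat 5 q ≤ 2)
    (W' : WeierstrassCurve ℚ) (hW' : W' = ⟨0, -1, 0, -2567861, 1583906801⟩) [W'.IsElliptic]
    (θ : geomTorsion W' ((5 : ℕ) : ℤ) ≃+ geomTorsion W ((5 : ℕ) : ℤ))
    (hθ : ∀ (σ : Field.absoluteGaloisGroup ℚ) (P : geomTorsion W' ((5 : ℕ) : ℤ)),
      θ (σ • P) = σ • θ P)
    (hrank : 2 ≤ W'.mordellWeilRank) : BSDp W 5 := by
  have hX : ClassX11a W 5 := classX11a_c283220bp2 W hWeq hr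
  have hsurj : Surj W 5 := ClassX11a.surj_of_not_dvd W 5 hX (by
    rw [minimalDiscriminantInt_eq (integralModelInt_eq_of_map_eq (W := W) _ (by rw [hWeq]; exact map_mk_int 0 (-1) 0 (-2709655426) 305187850967301)),
      padicValInt_eq_of_dvd_of_not_dvd 5 (e := 4) (by decide +kernel) (by decide +kernel)]
    decide)
  exact bsdp5_v283220bp2 hCT hW hGZK hmod W hWeq hX hsurj hq hv W' hW' θ hθ hrank

/-! ### `302400tb1 @ 7` -/

/-- **`302400tb1 = [0, 0, 0, -435114895500, 110921090442570000]` lies in class X11a at `7`, in the KERNEL up to `r_an = 0`**: `7 ∥ N`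
(`7 ∣ Δ = ±2⁶⁵·3¹¹·5⁸·7⁵`, `7 ∤ c₄`: multiplicative, Silverman VII.5.1 (b)); `E[7]` irreducible by the
Frobenius witness `ℓ = 17` (`#Ẽ(𝔽_17) = 12`, `a_17 = 6`, `X² − a_17X + 17` has no root mod `7`;
Mazur 1978 Prop. 6.3 (1)); no (ram) prime (`2` additive; `3` additive; `5` additive; `7 = p`). Displayed: `hr` (`r_an = 0`, Cremona).
[cite: SilvermanAEC2009, VII.5 Prop. 5.1] [cite: Mazur1978, §6 Prop. 6.3 (1) (p. 153)] [cite: Cremona2006, Table 1 (Cremona label 302400tb1)] -/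
theorem classX11a_c302400tb1 (W : WeierstrassCurve ℚ) [W.IsElliptic] [W.IsGloballyMinimal] [Fact (Nat.Prime 7)]
    (hWeq : W = ⟨0, 0, 0, -435114895500, 110921090442570000⟩) (hr : W.analyticRank = 0) : ClassX11a W 7 := by
  haveI : Fact (Nat.Prime 2) := ⟨Nat.prime_two⟩
  haveI : Fact (Nat.Prime 3) := ⟨Nat.prime_three⟩
  haveI : Fact (Nat.Prime 5) := ⟨by norm_num⟩
  haveI : Fact (Nat.Prime 17) := ⟨by norm_num⟩
  have hI : integralModelInt W = ⟨0, 0, 0, -435114895500, 110921090442570000⟩ := by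
    subst hWeq; exact integralModelInt_eq_of_map_eq _ (map_mk_int 0 0 0 (-435114895500) 110921090442570000)
  have hmult : Mult W 7 :=
    hasMultiplicativeReductionAtPrime_of_intModel hI 7 (by decide +kernel) (by decide +kernel)
  have hirr : Irr W 7 := by
    have hc : Nat.card (((⟨0, 0, 0, -435114895500, 110921090442570000⟩ : WeierstrassCurve ℤ).map
        (Int.castRingHom (ZMod 17))).toAffine.Point) = 12 := by
      have h := X11b.natCard_point_eq_countPoints 0 0 0 (-435114895500) 110921090442570000 17 (by norm_num)
        (by decide +kernel)
      have h' : countPoints [0, 0, 0, -435114895500, 110921090442570000] 17 = 12 := by decide +kernel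
      exact_mod_cast h.trans h'
    exact hasIrreducibleModPGaloisRep_of_intModel_of_noroot (hp := ⟨by norm_num⟩) (hℓ := ⟨by norm_num⟩)
      hI 7 17 (by norm_num) (by decide +kernel) hc (by decide)
  have hnram : ¬ Ram W 7 := not_ram_of_intModel hI 7 [2, 3, 5, 7] [65, 11, 8, 5]
    (by intro q hq; simp only [List.mem_cons, List.mem_nil_iff, or_false] at hq
        rcases hq with rfl | rfl | rfl | rfl <;> norm_num) (by decide +kernel)
    (by intro ℓ hℓ; simp only [List.mem_cons, List.mem_nil_iff, or_false] at hℓ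
        rcases hℓ with rfl | rfl | rfl | rfl
        · exact Or.inr (Or.inl (by decide +kernel))
        · exact Or.inr (Or.inl (by decide +kernel))
        · exact Or.inr (Or.inl (by decide +kernel))
        · exact Or.inl rfl)
  exact ⟨hr, by decide, hmult, hirr, hnram⟩

/-- **`302400tb1 @ 7`: `BSD(E,7)` with the class atoms in the kernel** — `bsdp7_v302400tb1`
(`X11a/VisibilityRecords16.lean`) with `hX` supplied by `classX11a_c302400tb1`; image bit in the kernel (très ramifié, `ClassX11a.surj_of_not_dvd`). Displayed binders
left: `hr` (`r_an = 0`), `hq`/`hv` (`#Ш_an = 49`), `θ`/`hθ` (the `7`-congruence), `hrank` (`rank F(ℚ) = 2`).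
PER PAIR; nothing booked. [cite: Wuthrich2014, Prop. 21 (p. 400)] [cite: CremonaMazur2000, §3 and Table 1]
[cite: Cremona2006, Table 1 (Cremona label 302400tb1)] -/
theorem bsdp7_a302400tb1 (hCT : exists_casselsTate_pairing (K := ℚ)) (hW : sha_dvd_analyticSha)
    (hGZK : rank_eq_analyticRank_of_analyticRank_le_one) (hmod : hasEntireLFunction_rat)
    (W : WeierstrassCurve ℚ) [W.IsElliptic] [W.IsGloballyMinimal] [Fact (Nat.Prime 7)]
    (hWeq : W = ⟨0, 0, 0, -435114895500, 110921090442570000⟩) (hr : W.analyticRank = 0)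
    {q : ℚ} (hq : shaAn W = (q : ℂ)) (hv : padicValRat 7 q ≤ 2)
    (W' : WeierstrassCurve ℚ) (hW' : W' = ⟨0, 0, 0, -7500, -210800⟩) [W'.IsElliptic]
    (θ : geomTorsion W' ((7 : ℕ) : ℤ) ≃+ geomTorsion W ((7 : ℕ) : ℤ))
    (hθ : ∀ (σ : Field.absoluteGaloisGroup ℚ) (P : geomTorsion W' ((7 : ℕ) : ℤ)),
      θ (σ • P) = σ • θ P)
    (hrank : 2 ≤ W'.mordellWeilRank) : BSDp W 7 := by
  have hX : ClassX11a W 7 := classX11a_c302400tb1 W hWeq hr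
  have hsurj : Surj W 7 := ClassX11a.surj_of_not_dvd W 7 hX (by
    rw [minimalDiscriminantInt_eq (integralModelInt_eq_of_map_eq (W := W) _ (by rw [hWeq]; exact map_mk_int 0 0 0 (-435114895500) 110921090442570000)),
      padicValInt_eq_of_dvd_of_not_dvd 7 (e := 5) (by decide +kernel) (by decide +kernel)]
    decide)
  exact bsdp7_v302400tb1 hCT hW hGZK hmod W hWeq hX hsurj hq hv W' hW' θ hθ hrank

/-! ### `317520eh1 @ 5` -/

/-- **`317520eh1 = [0, 0, 0, -68943, -6967702]` lies in class X11a at `5`, in the KERNEL up to `r_an = 0`**: `5 ∥ N`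
(`5 ∣ Δ = ±2⁸·3⁴·5·7⁸`, `5 ∤ c₄`: multiplicative, Silverman VII.5.1 (b)); `E[5]` irreducible by the
Frobenius witness `ℓ = 11` (`#Ẽ(𝔽_11) = 6`, `a_11 = 6`, `X² − a_11X + 11` has no root mod `5`;
Mazur 1978 Prop. 6.3 (1)); no (ram) prime (`2` additive; `3` additive; `5 = p`; `7` additive). Displayed: `hr` (`r_an = 0`, Cremona).
[cite: SilvermanAEC2009, VII.5 Prop. 5.1] [cite: Mazur1978, §6 Prop. 6.3 (1) (p. 153)] [cite: Cremona2006, Table 1 (Cremona label 317520eh1)] -/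
theorem classX11a_c317520eh1 (W : WeierstrassCurve ℚ) [W.IsElliptic] [W.IsGloballyMinimal] [Fact (Nat.Prime 5)]
    (hWeq : W = ⟨0, 0, 0, -68943, -6967702⟩) (hr : W.analyticRank = 0) : ClassX11a W 5 := by
  haveI : Fact (Nat.Prime 2) := ⟨Nat.prime_two⟩
  haveI : Fact (Nat.Prime 3) := ⟨Nat.prime_three⟩
  haveI : Fact (Nat.Prime 7) := ⟨by norm_num⟩
  haveI : Fact (Nat.Prime 11) := ⟨by norm_num⟩
  have hI : integralModelInt W = ⟨0, 0, 0, -68943, -6967702⟩ := by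
    subst hWeq; exact integralModelInt_eq_of_map_eq _ (map_mk_int 0 0 0 (-68943) (-6967702))
  have hmult : Mult W 5 :=
    hasMultiplicativeReductionAtPrime_of_intModel hI 5 (by decide +kernel) (by decide +kernel)
  have hirr : Irr W 5 := by
    have hc : Nat.card (((⟨0, 0, 0, -68943, -6967702⟩ : WeierstrassCurve ℤ).map
        (Int.castRingHom (ZMod 11))).toAffine.Point) = 6 := by
      have h := X11b.natCard_point_eq_countPoints 0 0 0 (-68943) (-6967702) 11 (by norm_num)
        (by decide +kernel)
      have h' : countPoints [0, 0, 0, -68943, -6967702] 11 = 6 := by decide +kernel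
      exact_mod_cast h.trans h'
    exact hasIrreducibleModPGaloisRep_of_intModel_of_noroot (hp := ⟨by norm_num⟩) (hℓ := ⟨by norm_num⟩)
      hI 5 11 (by norm_num) (by decide +kernel) hc (by decide)
  have hnram : ¬ Ram W 5 := not_ram_of_intModel hI 5 [2, 3, 5, 7] [8, 4, 1, 8]
    (by intro q hq; simp only [List.mem_cons, List.mem_nil_iff, or_false] at hq
        rcases hq with rfl | rfl | rfl | rfl <;> norm_num) (by decide +kernel)
    (by intro ℓ hℓ; simp only [List.mem_cons, List.mem_nil_iff, or_false] at hℓ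
        rcases hℓ with rfl | rfl | rfl | rfl
        · exact Or.inr (Or.inl (by decide +kernel))
        · exact Or.inr (Or.inl (by decide +kernel))
        · exact Or.inl rfl
        · exact Or.inr (Or.inl (by decide +kernel)))
  exact ⟨hr, by decide, hmult, hirr, hnram⟩

/-- **`317520eh1 @ 5`: `BSD(E,5)` with the class atoms in the kernel** — `bsdp5_v317520eh1`
(`X11a/VisibilityRecords9.lean`) with `hX` supplied by `classX11a_c317520eh1`; image bit in the kernel (très ramifié, `ClassX11a.surj_of_not_dvd`). Displayed binders
left: `hr` (`r_an = 0`), `hq`/`hv` (`#Ш_an = 25`), `θ`/`hθ` (the `5`-congruence), `hrank` (`rank F(ℚ) = 2`).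
PER PAIR; nothing booked. [cite: Wuthrich2014, Prop. 21 (p. 400)] [cite: CremonaMazur2000, §3 and Table 1]
[cite: Cremona2006, Table 1 (Cremona label 317520eh1)] -/
theorem bsdp5_a317520eh1 (hCT : exists_casselsTate_pairing (K := ℚ)) (hW : sha_dvd_analyticSha)
    (hGZK : rank_eq_analyticRank_of_analyticRank_le_one) (hmod : hasEntireLFunction_rat)
    (W : WeierstrassCurve ℚ) [W.IsElliptic] [W.IsGloballyMinimal] [Fact (Nat.Prime 5)]
    (hWeq : W = ⟨0, 0, 0, -68943, -6967702⟩) (hr : W.analyticRank = 0)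
    {q : ℚ} (hq : shaAn W = (q : ℂ)) (hv : padicValRat 5 q ≤ 2)
    (W' : WeierstrassCurve ℚ) (hW' : W' = ⟨0, 0, 0, -20433, 1124207⟩) [W'.IsElliptic]
    (θ : geomTorsion W' ((5 : ℕ) : ℤ) ≃+ geomTorsion W ((5 : ℕ) : ℤ))
    (hθ : ∀ (σ : Field.absoluteGaloisGroup ℚ) (P : geomTorsion W' ((5 : ℕ) : ℤ)),
      θ (σ • P) = σ • θ P)
    (hrank : 2 ≤ W'.mordellWeilRank) : BSDp W 5 := by
  have hX : ClassX11a W 5 := classX11a_c317520eh1 W hWeq hr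
  have hsurj : Surj W 5 := ClassX11a.surj_of_not_dvd W 5 hX (by
    rw [minimalDiscriminantInt_eq (integralModelInt_eq_of_map_eq (W := W) _ (by rw [hWeq]; exact map_mk_int 0 0 0 (-68943) (-6967702))),
      padicValInt_eq_of_dvd_of_not_dvd 5 (e := 1) (by decide +kernel) (by decide +kernel)]
    decide)
  exact bsdp5_v317520eh1 hCT hW hGZK hmod W hWeq hX hsurj hq hv W' hW' θ hθ hrank
end Summit.BirchSwinnertonDyer.Rank1Residual.X11a.VisibilityRecords

end
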